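import Summits.RiemannHypothesis.RiemannHypothesis.Theorems.OddSectorWindowLipschitzComparison
import Summits.RiemannHypothesis.RiemannHypothesis.Theorems.OddSectorWindowLipschitzLocalizedCut
import Summits.RiemannHypothesis.RiemannHypothesis.Theorems.OddSectorWindowLipschitzCommutatorBound
import Summits.RiemannHypothesis.RiemannHypothesis.Theorems.OddSectorOddOneSignedWindowsExistence
import Summits.RiemannHypothesis.RiemannHypothesis.Theorems.PfPersistenceParityTransportCalibration
import HarnessLib
import Summits.RiemannHypothesis.RiemannHypothesis.Theses.WeilParity

/-!
# Odd-sector window-Lipschitz, PART 6 (assembly): `ε_od` is Lipschitz on compact window ranges;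
# corollaries — the odd lower-Dini bound (114) and the calibration (115) of the T-P input become
# unconditional (pub-rhpf, transport-1, leaf G1.22 'TRANSPORT'; RH-free; def-free)

**mechanism/rigidity campaign; no RH claims.**  Companion text:
`run/shared/lean/pub/pub-rhpf/pub-rhpf-transport-1/TRANSPORT.md` §23 (odd-sector window-Lipschitz).

**What is proved (RH-free, hypothesis-free).**

* `oddWindowLipschitz` — the ODD-SECTOR WINDOW-LIPSCHITZ LAW: for `0 < b₀ ≤ A` there is `L` with
  `ε_od(b) − ε_od(a) ≤ L (a − b)` for all `b₀ ≤ b ≤ a ≤ A` (`ε_od = weilOddGroundEnergy`, the bottom of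
  Weil's quadratic form on the odd sector of the window `[−a, a]`).  This is VERBATIM the hypothesis `hoL`
  of `PfPersistenceParityTransport.oddLowerDini_of_oddWindowLipschitz` (113)/(114) and of
  `…splittingLeakage_iff_noParityCrossing_of_oddWindowLipschitz` (115), which were conditional on it.
* `oddLowerDini` — (114) unconditionally: the lower-Dini bound of `ε_od` on `[2/3, A)`.
* `splittingLeakage_iff_noParityCrossing` — (115) unconditionally: the T-P leakage input of the
  parity transport (G1.22) is EXACTLY `WeilParity.NoParityCrossing` (an open route item, asserted of
  nothing here): `SplittingLeakage ↔ NoParityCrossing`.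

**Proof.** The odd-sector twin of the tree's 28-file proof of `WeilWindowFlow.WindowLipschitz` (line
`borderline-barrier` ∘ `cut-dont-squeeze`), assembled exactly as `WindowLipschitz_proof`: the
`u`-INDEPENDENT half of that proof — pointwise surplus of the two-scale barrier (`windowLipschitz_surplus
stub_surplusReduction stub_surplusCalculus`), its weak form (`windowLipschitz_weakSurplus · stub_barrierWeakForm`)
and its form-domain membership (`stub_barrierEnergy`) — is IMPORTED; the `u`-dependent half is re-run on
the odd sector in PARTS 1–5: (C2) `oddGroundState_finiteEnergy'`, (EL, all directions — the one new
ingredient, by reflection symmetry) `oddGroundState_eulerLagrange_all`, (A) `oddSupBound`, (P) the weak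
maximum principle `oddComparison`, (B) `oddEdgeMassLaw_of_pointwise`, (D) `oddLocalizedCut` (even cutoffs;
(C1_od) = `OddSector.odd_formDomainPos_ae`), (E) `oddCommutatorBound`; then the one-step bound with the EVEN
cutoff `clamp((a − h − |x|)/h)` and an odd-sector ground state (`OddSector.exists_isWeilOddGroundState`),
and the local-to-compact glue with `weilOddGroundEnergy_antitone`.

Labels: PROVED tree material only (RH-free); no hypothesis anywhere in the chain is an open item.
`NoParityCrossing` (route WeilParity) stays OPEN and is asserted of nothing.  Nothing here is a step
toward RH: the calibration says the transport input is equivalent to an open sign statement, no more.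

References: E. Bombieri, Rend. Mat. Acc. Lincei (9) 11 (2000), §4 (variational equation, Thm 3);
H. Chen, T. Weth, CPDE 44 (2019), arXiv:1710.03416, §§3–4; V. Hernández-Santamaría, L. F. López Ríos,
A. Saldaña, arXiv:2401.18033; P. A. Feulefack, S. Jarohs, T. Weth, arXiv:2010.10448, §3.
-/

set_option linter.dupNamespace false  -- D-0017 nested layout: `RiemannHypothesis.RiemannHypothesis`

noncomputable section

open MeasureTheory Set Filter
open scoped Topology ENNReal NNReal

namespace Summit.RiemannHypothesis.RiemannHypothesis.Theorems.OddSectorWindowLipschitz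

open Literature.NumberTheory.LFunctions
open Summit.RiemannHypothesis.RiemannHypothesis.Theorems.WeilWindowFlowWindowLipschitz

/-! ### (B) from (P), odd sector -/

/-- **Pointwise edge law ⇒ `L²` edge-mass law, odd sector** (odd twin of
`windowLipschitz_edgeMassLaw_of_pointwise`, verbatim: `u = 0` a.e. off `[−a, a]`, the layer has measure `2r`,
and on it `log(1/(a−|x|)) ≥ log(1/r)`). -/
theorem oddEdgeMassLaw_of_pointwise
    (hP : ∀ b₀ A : ℝ, 0 < b₀ → b₀ ≤ A → ∃ K d₀ : ℝ, 0 < d₀ ∧ d₀ < 1 ∧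
      ∀ (a : ℝ) (u : ℝ → ℂ), b₀ ≤ a → a ≤ A → IsWeilOddGroundState a u →
        ∀ᵐ x : ℝ, a - d₀ < |x| → |x| < a → ‖u x‖ ^ 2 * Real.log (1 / (a - |x|)) ≤ K) :
    ∀ b₀ A : ℝ, 0 < b₀ → b₀ ≤ A → ∃ K d₀ : ℝ, 0 < d₀ ∧ d₀ < 1 ∧
      ∀ (a r : ℝ) (u : ℝ → ℂ), b₀ ≤ a → a ≤ A → IsWeilOddGroundState a u → 0 < r → r ≤ d₀ →
        ∫ x in {x : ℝ | a - r < |x|}, ‖u x‖ ^ 2 ≤ K * r / Real.log (1 / r) := by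
  intro b₀ A hb₀ hb₀A
  obtain ⟨K, d₀, hd₀, hd₀1, hK⟩ := hP b₀ A hb₀ hb₀A
  refine ⟨2 * max K 0, d₀, hd₀, hd₀1, ?_⟩
  intro a r u ha haA hu hr hrd
  have hr1 : r < 1 := lt_of_le_of_lt hrd hd₀1
  have hlogr : 0 < Real.log (1 / r) := by
    apply Real.log_pos
    rw [lt_div_iff₀ hr, one_mul]
    exact hr1
  have hc0 : 0 ≤ max K 0 / Real.log (1 / r) := div_nonneg (le_max_right _ _) hlogr.le
  have hSm : MeasurableSet {x : ℝ | a - r < |x|} :=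
    (isOpen_lt continuous_const continuous_abs).measurableSet
  -- Step 1: the integral over the (infinite-measure) set is the integral over its trace on the window
  have hind : ∀ᵐ x : ℝ, ‖u x‖ ^ 2 = (Icc (-a) a).indicator (fun x ↦ ‖u x‖ ^ 2) x := by
    filter_upwards [hu.ae_eq_zero_of_notMem] with x hx
    by_cases hm : x ∈ Icc (-a) a
    · simp [hm]
    · simp [hm, hx hm]
  have hST : ∫ x in {x : ℝ | a - r < |x|}, ‖u x‖ ^ 2 =
      ∫ x in {x : ℝ | a - r < |x|} ∩ Icc (-a) a, ‖u x‖ ^ 2 := by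
    rw [integral_congr_ae (ae_restrict_of_ae hind), setIntegral_indicator measurableSet_Icc]
  -- Step 2: the trace has measure at most `2r`
  have hTsub : {x : ℝ | a - r < |x|} ∩ Icc (-a) a ⊆ Icc (a - r) a ∪ Icc (-a) (-(a - r)) := by
    intro x hx
    obtain ⟨hxS, hxI⟩ := hx
    simp only [mem_setOf_eq] at hxS
    rcases le_or_gt 0 x with h0 | h0
    · left
      rw [abs_of_nonneg h0] at hxS
      exact ⟨hxS.le, hxI.2⟩
    · right
      rw [abs_of_neg h0] at hxS
      exact ⟨hxI.1, by linarith⟩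
  have hUfin : volume (Icc (a - r) a ∪ Icc (-a) (-(a - r))) < ∞ :=
    lt_of_le_of_lt (measure_union_le _ _)
      (by simp [Real.volume_Icc] : volume (Icc (a - r) a) + volume (Icc (-a) (-(a - r))) < ∞)
  have hTfin : volume ({x : ℝ | a - r < |x|} ∩ Icc (-a) a) < ∞ := (measure_mono hTsub).trans_lt hUfin
  have hTreal : volume.real ({x : ℝ | a - r < |x|} ∩ Icc (-a) a) ≤ 2 * r := by
    calc volume.real ({x : ℝ | a - r < |x|} ∩ Icc (-a) a)
        ≤ volume.real (Icc (a - r) a ∪ Icc (-a) (-(a - r))) := measureReal_mono hTsub hUfin.ne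
      _ ≤ volume.real (Icc (a - r) a) + volume.real (Icc (-a) (-(a - r))) := measureReal_union_le _ _
      _ = r + r := by
          rw [Real.volume_real_Icc_of_le (by linarith), Real.volume_real_Icc_of_le (by linarith)]
          ring
      _ = 2 * r := by ring
  -- Step 3: a.e. on the trace, `‖u x‖² ≤ max K 0 / log(1/r)`
  have hbd : ∀ᵐ x : ℝ, x ∈ {x : ℝ | a - r < |x|} ∩ Icc (-a) a →
      ‖(‖u x‖ ^ 2 : ℝ)‖ ≤ max K 0 / Real.log (1 / r) := by
    filter_upwards [hK a u ha haA hu, Measure.ae_ne volume a, Measure.ae_ne volume (-a)]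
      with x hx hxa hxna
    intro hxT
    obtain ⟨hxS, hxI⟩ := hxT
    simp only [mem_setOf_eq] at hxS
    rw [Real.norm_of_nonneg (by positivity)]
    have hxa' : |x| < a := by
      rcases (abs_le.2 ⟨hxI.1, hxI.2⟩).lt_or_eq with hlt | heq
      · exact hlt
      · exfalso
        rcases le_or_gt 0 x with h0 | h0
        · rw [abs_of_nonneg h0] at heq
          exact hxa heq
        · rw [abs_of_neg h0] at heq
          exact hxna (by linarith)
    have hd : 0 < a - |x| := sub_pos.2 hxa'
    have hdr : a - |x| < r := by linarith
    have hlogx : Real.log (1 / r) ≤ Real.log (1 / (a - |x|)) :=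
      Real.log_le_log (by positivity) (one_div_le_one_div_of_le hd hdr.le)
    have hlogx0 : 0 < Real.log (1 / (a - |x|)) := hlogr.trans_le hlogx
    have h1 : ‖u x‖ ^ 2 * Real.log (1 / (a - |x|)) ≤ K := hx (by linarith) hxa'
    have h2 : ‖u x‖ ^ 2 * Real.log (1 / (a - |x|)) ≤ max K 0 := h1.trans (le_max_left _ _)
    calc ‖u x‖ ^ 2 ≤ max K 0 / Real.log (1 / (a - |x|)) := by
          rw [le_div_iff₀ hlogx0]
          exact h2
      _ ≤ max K 0 / Real.log (1 / r) :=
          div_le_div_of_nonneg_left (le_max_right _ _) hlogr hlogx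
  -- Step 4: assemble
  have hnorm := norm_setIntegral_le_of_norm_le_const_ae' hTfin hbd
  rw [hST]
  calc ∫ x in {x : ℝ | a - r < |x|} ∩ Icc (-a) a, ‖u x‖ ^ 2
      ≤ ‖∫ x in {x : ℝ | a - r < |x|} ∩ Icc (-a) a, ‖u x‖ ^ 2‖ := Real.le_norm_self _
    _ ≤ max K 0 / Real.log (1 / r) * volume.real ({x : ℝ | a - r < |x|} ∩ Icc (-a) a) := hnorm
    _ ≤ max K 0 / Real.log (1 / r) * (2 * r) := mul_le_mul_of_nonneg_left hTreal hc0
    _ = 2 * max K 0 * r / Real.log (1 / r) := by ring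

/-! ### One step and local-to-compact, odd sector -/

/-- **The one-step bound from (D_od) and (E_od)** (odd twin of `windowLipschitz_oneStep_of`): for
`a ∈ [b₀, A]` and `0 < h ≤ h₁ := min h₀ (b₀/2)` take an odd-sector ground state `u` of the window `a`
(`OddSector.exists_isWeilOddGroundState`, PROVED) and the EVEN piecewise-linear cutoff
`χ(x) = max (min ((a − h − |x|)/h) 1) 0`; (D_od) at `b = a − h` and (E_od) give
`(ε_od(a−h) − ε_od(a)) · ∫‖χu‖² ≤ C h` with `∫‖χu‖² ≥ 1/2`, and `ε_od` is antitone
(`weilOddGroundEnergy_antitone`), so `ε_od(a−h) − ε_od(a) ≤ 2 max(C,0) h`. -/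
theorem oddOneStep_of
    (hD : (∀ (a b : ℝ) (K : ℝ≥0) (u : ℝ → ℂ) (χ : ℝ → ℝ), 0 < b → b ≤ a → IsWeilOddGroundState a u →
        LipschitzWith K χ → (∀ x, 0 ≤ χ x ∧ χ x ≤ 1) → (∀ x, b ≤ |x| → χ x = 0) →
        (∀ x, χ (-x) = χ x) →
        (weilOddGroundEnergy b - weilOddGroundEnergy a) * ∫ x, ‖(χ x : ℂ) * u x‖ ^ 2 ≤
          (∫ t in Ioi (0 : ℝ), weilArchDensity t *
              ∫ x, (χ (x + t) - χ x) ^ 2 * (‖u (x + t)‖ * ‖u x‖)) +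
          (∑ n ∈ weilPrimeIndex a, (ArithmeticFunction.vonMangoldt n : ℝ) / Real.sqrt n *
              ∫ x, (χ (x + Real.log n) - χ x) ^ 2 * (‖u (x + Real.log n)‖ * ‖u x‖)) +
          2 * ‖∫ t, ((1 - χ t : ℝ) : ℂ) * u t * (Real.cosh (t / 2) : ℂ)‖ ^ 2 +
          2 * ‖∫ t, u t * (Real.cosh (t / 2) : ℂ)‖ *
              ‖∫ t, (((1 - χ t) ^ 2 : ℝ) : ℂ) * u t * (Real.cosh (t / 2) : ℂ)‖ +
          2 * ‖∫ t, u t * (Real.sinh (t / 2) : ℂ)‖ *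
              ‖∫ t, (((1 - χ t) ^ 2 : ℝ) : ℂ) * u t * (Real.sinh (t / 2) : ℂ)‖))
    (hEst : (∀ b₀ A : ℝ, 0 < b₀ → b₀ ≤ A → ∃ C h₀ : ℝ, 0 < h₀ ∧
        ∀ (a h : ℝ) (u : ℝ → ℂ) (χ : ℝ → ℝ), b₀ ≤ a → a ≤ A → 0 < h → h ≤ h₀ →
        IsWeilOddGroundState a u → (∀ x y, |χ x - χ y| ≤ |x - y| / h) → (∀ x, 0 ≤ χ x ∧ χ x ≤ 1) →
        (∀ x, |x| ≤ a - 2 * h → χ x = 1) → (∀ x, a - h ≤ |x| → χ x = 0) →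
        (∫ t in Ioi (0 : ℝ), weilArchDensity t *
              ∫ x, (χ (x + t) - χ x) ^ 2 * (‖u (x + t)‖ * ‖u x‖)) +
          (∑ n ∈ weilPrimeIndex a, (ArithmeticFunction.vonMangoldt n : ℝ) / Real.sqrt n *
              ∫ x, (χ (x + Real.log n) - χ x) ^ 2 * (‖u (x + Real.log n)‖ * ‖u x‖)) +
          2 * ‖∫ t, ((1 - χ t : ℝ) : ℂ) * u t * (Real.cosh (t / 2) : ℂ)‖ ^ 2 +
          2 * ‖∫ t, u t * (Real.cosh (t / 2) : ℂ)‖ *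
              ‖∫ t, (((1 - χ t) ^ 2 : ℝ) : ℂ) * u t * (Real.cosh (t / 2) : ℂ)‖ +
          2 * ‖∫ t, u t * (Real.sinh (t / 2) : ℂ)‖ *
              ‖∫ t, (((1 - χ t) ^ 2 : ℝ) : ℂ) * u t * (Real.sinh (t / 2) : ℂ)‖ ≤ C * h ∧
          1 / 2 ≤ ∫ x, ‖(χ x : ℂ) * u x‖ ^ 2)) :
    ∀ b₀ A : ℝ, 0 < b₀ → b₀ ≤ A → ∃ C h₁ : ℝ, 0 < h₁ ∧ h₁ ≤ b₀ / 2 ∧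
      ∀ a h : ℝ, b₀ ≤ a → a ≤ A → 0 < h → h ≤ h₁ →
        weilOddGroundEnergy (a - h) - weilOddGroundEnergy a ≤ C * h := by
  intro b₀ A hb₀ hb₀A
  obtain ⟨C, h₀, hh₀, hest⟩ := hEst b₀ A hb₀ hb₀A
  -- shrink the admissible width so that the small window `a - h` stays positive (the floor `0 < b₀` is used here)
  set h₁ : ℝ := min h₀ (b₀ / 2) with hh₁def
  have hh₁ : 0 < h₁ := lt_min hh₀ (by linarith)
  have hh₁₀ : h₁ ≤ h₀ := min_le_left _ _
  have hh₁b : h₁ ≤ b₀ / 2 := min_le_right _ _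
  refine ⟨2 * max C 0, h₁, hh₁, hh₁b, ?_⟩
  intro a h ha haA hh hhle
  have ha0 : 0 < a := lt_of_lt_of_le hb₀ ha
  have hb : 0 < a - h := by linarith
  obtain ⟨u, hu⟩ := OddSector.exists_isWeilOddGroundState ha0
  -- the piecewise-linear cutoff of width `h`
  set χ : ℝ → ℝ := fun x ↦ max (min ((a - h - |x|) / h) 1) 0 with hχdef
  have hχ01 : ∀ x, 0 ≤ χ x ∧ χ x ≤ 1 := fun x ↦
    ⟨le_max_right _ _, max_le (min_le_right _ _) zero_le_one⟩
  have hχone : ∀ x, |x| ≤ a - 2 * h → χ x = 1 := by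
    intro x hx
    have h1p : 1 ≤ (a - h - |x|) / h := by
      rw [le_div_iff₀ hh]
      linarith
    show max (min ((a - h - |x|) / h) 1) 0 = 1
    rw [min_eq_right h1p, max_eq_left (zero_le_one' ℝ)]
  have hχzero : ∀ x, a - h ≤ |x| → χ x = 0 := by
    intro x hx
    have hp : (a - h - |x|) / h ≤ 0 := by
      rw [div_le_iff₀ hh, zero_mul]
      linarith
    show max (min ((a - h - |x|) / h) 1) 0 = 0
    exact max_eq_right ((min_le_left _ _).trans hp)
  have hχlip : ∀ x y, |χ x - χ y| ≤ |x - y| / h := by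
    intro x y
    calc |χ x - χ y|
        = |max (min ((a - h - |x|) / h) 1) 0 - max (min ((a - h - |y|) / h) 1) 0| := rfl
      _ ≤ |min ((a - h - |x|) / h) 1 - min ((a - h - |y|) / h) 1| := abs_max_sub_max_le_abs _ _ _
      _ ≤ max |(a - h - |x|) / h - (a - h - |y|) / h| |(1 : ℝ) - 1| := abs_min_sub_min_le_max _ _ _ _
      _ = |(a - h - |x|) / h - (a - h - |y|) / h| := by
          rw [sub_self, abs_zero, max_eq_left (abs_nonneg _)]
      _ = |(|y| - |x|)| / h := by
          rw [show (a - h - |x|) / h - (a - h - |y|) / h = (|y| - |x|) / h by ring, abs_div,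
            abs_of_pos hh]
      _ ≤ |x - y| / h := by
          rw [div_le_div_iff_of_pos_right hh, abs_sub_comm x y]
          exact abs_abs_sub_abs_le_abs_sub y x
  have hχeven : ∀ x, χ (-x) = χ x := fun x ↦ by
    show max (min ((a - h - |-x|) / h) 1) 0 = max (min ((a - h - |x|) / h) 1) 0
    rw [abs_neg]
  have hχLW : LipschitzWith (Real.toNNReal (1 / h)) χ := by
    refine LipschitzWith.of_dist_le_mul fun x y ↦ ?_
    rw [Real.dist_eq, Real.dist_eq, Real.coe_toNNReal _ (by positivity)]
    calc |χ x - χ y| ≤ |x - y| / h := hχlip x y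
      _ = 1 / h * |x - y| := by ring
  -- (D) at `b = a - h` and (E)
  have hcut := hD a (a - h) (Real.toNNReal (1 / h)) u χ hb (by linarith) hu hχLW hχ01 hχzero hχeven
  obtain ⟨hR, hm⟩ := hest a h u χ ha haA hh (hhle.trans hh₁₀) hu hχlip hχ01 hχone hχzero
  have hanti : 0 ≤ weilOddGroundEnergy (a - h) - weilOddGroundEnergy a :=
    sub_nonneg.2 (weilOddGroundEnergy_antitone hb (by linarith))
  have h1 : (weilOddGroundEnergy (a - h) - weilOddGroundEnergy a) * (1 / 2) ≤ C * h :=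
    le_trans (mul_le_mul_of_nonneg_left hm hanti) (hcut.trans hR)
  have h2 : C * h ≤ max C 0 * h := mul_le_mul_of_nonneg_right (le_max_left C 0) hh.le
  linarith

/-- **Local-to-compact glue, odd sector** (odd twin of `windowLipschitz_lipschitzBound_of_oneStep`): a
one-step bound `ε_od(a−h) − ε_od(a) ≤ C h` for `0 < h ≤ h₁` on `[b₀, A]` gives the Lipschitz bound with
`L := max C 0 + |ε_od(b₀) − ε_od(A)|/h₁` (gaps `> h₁` paid by antitonicity). -/
theorem oddLipschitzBound_of_oneStep {b₀ A C h₁ : ℝ} (hb₀ : 0 < b₀) (hh₁ : 0 < h₁)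
    (hstep : ∀ a h : ℝ, b₀ ≤ a → a ≤ A → 0 < h → h ≤ h₁ →
      weilOddGroundEnergy (a - h) - weilOddGroundEnergy a ≤ C * h) :
    ∃ L : ℝ, ∀ b a : ℝ, b₀ ≤ b → b ≤ a → a ≤ A →
      weilOddGroundEnergy b - weilOddGroundEnergy a ≤ L * (a - b) := by
  set M : ℝ := |weilOddGroundEnergy b₀ - weilOddGroundEnergy A| with hM
  have hM0 : 0 ≤ M := abs_nonneg _
  have hMh : 0 ≤ M / h₁ := div_nonneg hM0 hh₁.le
  refine ⟨max C 0 + M / h₁, ?_⟩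
  intro b a hb hba haA
  have hb0 : 0 < b := lt_of_lt_of_le hb₀ hb
  have ha0 : 0 < a := lt_of_lt_of_le hb0 hba
  rcases eq_or_lt_of_le hba with heq | hlt
  · subst heq
    simp
  · by_cases hsmall : a - b ≤ h₁
    · have hpos : 0 < a - b := sub_pos.2 hlt
      have h1 := hstep a (a - b) (le_trans hb hba) haA hpos hsmall
      rw [sub_sub_cancel] at h1
      calc weilOddGroundEnergy b - weilOddGroundEnergy a ≤ C * (a - b) := h1
        _ ≤ (max C 0 + M / h₁) * (a - b) := by
            apply mul_le_mul_of_nonneg_right _ hpos.le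
            linarith [le_max_left C 0]
    · have hlarge : h₁ < a - b := lt_of_not_ge hsmall
      have e1 : weilOddGroundEnergy b ≤ weilOddGroundEnergy b₀ := weilOddGroundEnergy_antitone hb₀ hb
      have e2 : weilOddGroundEnergy A ≤ weilOddGroundEnergy a := weilOddGroundEnergy_antitone ha0 haA
      have h2 : weilOddGroundEnergy b - weilOddGroundEnergy a ≤ M :=
        le_trans (by linarith) (le_abs_self _)
      calc weilOddGroundEnergy b - weilOddGroundEnergy a ≤ M := h2
        _ = (M / h₁) * h₁ := by field_simp
        _ ≤ (M / h₁) * (a - b) := mul_le_mul_of_nonneg_left hlarge.le hMh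
        _ ≤ (max C 0 + M / h₁) * (a - b) := by
            apply mul_le_mul_of_nonneg_right _ (sub_nonneg.2 hba)
            linarith [le_max_right C 0]

/-! ### The odd-sector window-Lipschitz law -/

/-- **Odd-sector window-Lipschitz law** (RH-free, hypothesis-free): for `0 < b₀ ≤ A` there is `L` with
`ε_od(b) − ε_od(a) ≤ L · (a − b)` whenever `b₀ ≤ b ≤ a ≤ A`.  Verbatim the hypothesis `hoL` of (113)–(115)
(`PfPersistenceParityTransportCalibration`).  Composition exactly as `WindowLipschitz_proof`, with the
odd-sector PARTS 1–5 in place of the even `u`-dependent stubs and the `u`-independent barrier half imported.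
[cite: Bombieri2000Weil, §4 Thm 3] -/
theorem oddWindowLipschitz :
    ∀ b₀ A : ℝ, 0 < b₀ → b₀ ≤ A → ∃ L : ℝ, ∀ b a : ℝ, b₀ ≤ b → b ≤ a → a ≤ A →
      weilOddGroundEnergy b - weilOddGroundEnergy a ≤ L * (a - b) := by
  have hC2 := oddGroundState_finiteEnergy'
  have hEL := oddGroundState_eulerLagrange_all
  have hA := oddSupBound hC2 hEL
  have hS := windowLipschitz_surplus stub_surplusReduction stub_surplusCalculus
  have hW := windowLipschitz_weakSurplus hS stub_barrierWeakForm
  have hP := oddComparison stub_barrierEnergy hW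
  have hB := oddEdgeMassLaw_of_pointwise hP
  have hD := oddLocalizedCut
  have hE := oddCommutatorBound hA hB
  intro b₀ A hb₀ hb₀A
  obtain ⟨C, h₁, hh₁, -, hstep⟩ := oddOneStep_of hD hE b₀ A hb₀ hb₀A
  exact oddLipschitzBound_of_oneStep hb₀ hh₁ hstep

/-! ### Corollaries: (114) and (115) unconditionally -/

/-- (114) **The odd lower-Dini bound, unconditionally**: on `[2/3, A)` there is `L` such that for every
`x`, `η > 0`, `δ > 0` some `0 < h < δ` has `ε_od(x) − ε_od(x+h) ≤ h (L + η)`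
(`PfPersistenceParityTransport.oddLowerDini_of_oddWindowLipschitz oddWindowLipschitz`). [folklore] -/
theorem oddLowerDini :
    ∀ A : ℝ, 2 / 3 ≤ A → ∃ L : ℝ, ∀ x ∈ Ico (2 / 3 : ℝ) A, ∀ η δ : ℝ, 0 < η → 0 < δ →
      ∃ h : ℝ, 0 < h ∧ h < δ ∧
        weilOddGroundEnergy x - weilOddGroundEnergy (x + h) ≤ h * (L + η) :=
  PfPersistenceParityTransport.oddLowerDini_of_oddWindowLipschitz oddWindowLipschitz

/-- (115) **Calibration of the T-P input, unconditionally**: the splitting-leakage input of the parity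
transport (`PfPersistenceParityTransport`, (109)–(112)) holds IF AND ONLY IF `WeilParity.NoParityCrossing`
(open route item; asserted of nothing).  So the transport layer of G1.22 adds exactly nothing to, and loses
exactly nothing from, the parity sign law. [folklore] -/
theorem splittingLeakage_iff_noParityCrossing :
    (∀ A : ℝ, 2 / 3 ≤ A → ∃ K : ℝ, ∀ x ∈ Ico (2 / 3 : ℝ) A, ∀ η δ : ℝ, 0 < η → 0 < δ →
      ∃ h : ℝ, 0 < h ∧ h < δ ∧
        (weilOddGroundEnergy x - weilEvenGroundEnergy x) -
            (weilOddGroundEnergy (x + h) - weilEvenGroundEnergy (x + h)) ≤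
          h * (K * (weilOddGroundEnergy x - weilEvenGroundEnergy x) + η)) ↔
    Summit.RiemannHypothesis.RiemannHypothesis.Theses.WeilParity.NoParityCrossing :=
  PfPersistenceParityTransport.splittingLeakage_iff_noParityCrossing_of_oddWindowLipschitz
    oddWindowLipschitz

end Summit.RiemannHypothesis.RiemannHypothesis.Theorems.OddSectorWindowLipschitz

end
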